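import Literature.NumberTheory.EllipticCurves.CMNewformGamma0PrimitiveIsNewformProofs
import Literature.NumberTheory.EllipticCurves.HeckeGrossencharakterFunctionalEquationConductorProofs
import HarnessLib

/-!
# Shimura 1971/72 (Ribet 1977 §3 Remark (3.5); Miyake Thm. 4.8.2): the theta series of a PRIMITIVE Größencharakter of an
# imaginary quadratic field is a newform of level `|d_K|·N𝔣` — the named fact HOLDS

Topic `Literature/NumberTheory/EllipticCurves`; namespace `Literature.NumberTheory.EllipticCurves.ModularForms`.  THEOREMS ONLY (no definition,
no named fact, no instance, no `sorry`).  `CMNewformGamma0PrimitiveIsNewformProofs.lean` proved the named fact `shimura1972_heckeTheta_isNewform0_of_primitive`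
(`CMNewformGamma0PrimitiveIsNewform.lean`) MODULO Hecke's functional equation with conductor (`shimura1972_heckeTheta_isNewform0_of_primitive_of_heckeFE`, by
Li's criterion); `HeckeGrossencharakterFunctionalEquationConductorProofs.lean` now PROVES that functional equation
(`Hecke_functionalEquation_infinityType_conductor_holds`, Hecke's theta integral with the harmonic weight `σ_w^m`, Neukirch VII (8.5)–(8.6)).
Composing the two discharges Shimura's remark:

* ★ `shimura1972_heckeTheta_isNewform0_of_primitive_holds : shimura1972_heckeTheta_isNewform0_of_primitive`.

References: [Ribet1977Nebentypus] §3 Remark (3.5); [Shimura1972ClassFieldsRealQuadratic] p. 138; [Miyake2006] Thm. 4.8.2; [Li1975] Thm. 9;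
[deShalit1987] II §1.1 (1)–(3); [NeukirchANT1999] Ch. VII §8 (8.5)–(8.6).  Filed for crux L of `Summits/BirchSwinnertonDyer` (and the
`FreyModularity` lines of `Summits/ABC` that take the fact as a hypothesis); nothing about BSD is proved here.
`lean search 'isNewform0_of_primitive_holds'` (2026-09-01): none.
-/

noncomputable section

namespace Literature.NumberTheory.EllipticCurves.ModularForms

/-- ★ **Shimura's remark HOLDS** (Ribet 1977 §3 Remark (3.5): «Shimura [26, p. 138] has pointed out that `g` is a newform if `𝔪` is the
conductor of `ψ`»; Miyake Thm. 4.8.2): every cusp form of weight `k ≥ 2` on `Γ₀(|d_K|·N𝔣)` whose `q`-expansion is the theta series of a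
PRIMITIVE Größencharakter `ψ mod 𝔣` of type `σ^{k-1}` of an imaginary quadratic field (trivial Nebentypus) is a newform — the named fact
`shimura1972_heckeTheta_isNewform0_of_primitive` VERBATIM, now unconditional: Li's criterion (`…_of_heckeFE`) fed with the PROVED Hecke functional
equation with conductor (`Hecke_functionalEquation_infinityType_conductor_holds`).
[cite: Ribet1977Nebentypus, §3 Remark (3.5) (LNM 601, p. 35)] [cite: Shimura1972ClassFieldsRealQuadratic, p. 138] [cite: Miyake2006, Thm. 4.8.2]
[cite: Li1975, Thm. 9] [cite: NeukirchANT1999, Ch. VII §8 Thm. (8.5), Cor. (8.6)] -/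
theorem shimura1972_heckeTheta_isNewform0_of_primitive_holds : shimura1972_heckeTheta_isNewform0_of_primitive :=
  shimura1972_heckeTheta_isNewform0_of_primitive_of_heckeFE Hecke_functionalEquation_infinityType_conductor_holds

end Literature.NumberTheory.EllipticCurves.ModularForms

end
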